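import Literature.Analysis.FluidPDE.SereginZajaczkowski2007
import Literature.Analysis.FluidPDE.AxisymNoSwirlScalarEq
import Literature.Analysis.FluidPDE.ClassicalSuitable
import Literature.Analysis.FluidPDE.ClassicalSolutionCalculus
import HarnessLib

/-!
# Seregin–Zajaczkowski 2007, (4.15): rotated test fields and the test fields `φ J`

G. Seregin, W. Zajaczkowski, *A sufficient condition of regularity for axially symmetric
solutions to the Navier–Stokes equations*, SIAM J. Math. Anal. 39 (2007) 669–685 =
arXiv:math/0702720, §4, proof of Lemma 4.3: "We know that `V_φ` satisfies the equation (4.15)"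
(the swirl equation). Support file (everything proved; no named facts) for the discharge of the
named fact `SereginZajaczkowski2007.SwirlEquation` (`SereginZajaczkowski2007SwirlEquation.lean`):
the swirl equation is obtained by testing the distributional momentum equation with the vector
fields `ψ = φ J`, `J x = (-x₁, x₀, 0) = ϱ e_φ` (`rotGen`), `φ ∈ C_c^∞(Q)` scalar, and the pressure
is removed by a rotation argument which tests it with the conjugated fields
`ψ_θ(t, x) = R_θ⁻¹ ψ(t, R_θ x)`. This file provides the calculus of both families:

* `φ J` is a test field and `∂ₜ(φJ) = ∂ₜφ J`, `⟪u, (u·∇)(φJ)⟫ = Dφ[u] Γ`, `div(φJ) = ⟪J, ∇φ⟫`,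
  `⟪u, Δ(φJ)⟫ = Δφ Γ - 2⟪Ju, ∇φ⟫` (`Γ = x₀u₁ - x₁u₀` the swirl; `isSpaceTimeTestOn_smul_rotGen`,
  `timeDeriv_smul_rotGen`, `inner_convect_smul_rotGen`, `divergence_smul_rotGen`,
  `inner_laplacian_smul_rotGen`);
* the space–time rotations `stRot θ (t, x) = (t, R_θ x)` (measure preserving, measurable
  embeddings), rotation of test functions on rotation-invariant open sets
  (`isSpaceTimeTestOn_comp_stRot`, `isSpaceTimeTestOn_rotConj`), and the covariance of the weak
  Navier–Stokes integrand: for `V` equivariant at the points of `Q`, the velocity part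
  `⟪V, ∂ₜψ_θ⟫ + ⟪V, (V·∇)ψ_θ⟫ + ν⟪V, Δψ_θ⟫` at `(t, x)` equals the velocity part for `ψ` at
  `(t, R_θ x)` (`nsVPart_rotConj`), and `div ψ_θ (t, x) = (div ψ)(t, R_θ x)` (`divergence_rotConj`)
  — the tree's `IsometryInvariance` (Majda–Bertozzi, Prop. 1.1 (iii)) read for test fields.

## References

* G. Seregin, W. Zajaczkowski, SIAM J. Math. Anal. 39 (2007) 669–685, arXiv:math/0702720, §4
  proof of Lemma 4.3, (4.15). [`SereginZajaczkowski2007`]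
* A. J. Majda, A. L. Bertozzi, *Vorticity and Incompressible Flow* (CUP 2002), §1.2,
  Prop. 1.1 (iii) (rotation symmetry of the equations).
-/

noncomputable section

open MeasureTheory Set Function Filter Topology TopologicalSpace Metric WithLp
open scoped NNReal ENNReal ContDiff InnerProductSpace RealInnerProductSpace Laplacian

namespace Literature.Analysis.FluidPDE

namespace SereginZajaczkowski2007

open SereginSverak2009

/-- Local notation for physical space `ℝ³ = EuclideanSpace ℝ (Fin 3)`. -/
local notation "ℝ³" => EuclideanSpace ℝ (Fin 3)

/-! ### The infinitesimal rotation and the test fields `φ J` -/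

section RotGenTests

variable {Q : Opens (ℝ × ℝ³)} {φ : ℝ → ℝ³ → ℝ}

/-- `⟪J x, u x⟫ = x₀ u₁ - x₁ u₀` is the swirl. [folklore] -/
theorem inner_rotGen_eq_swirl (u : ℝ³ → ℝ³) (x : ℝ³) : ⟪rotGen x, u x⟫ = swirl u x := by
  rw [inner_rotGen_left]
  rfl

/-- `⟪u x, J x⟫ = x₀ u₁ - x₁ u₀` is the swirl. [folklore] -/
theorem inner_rotGen_eq_swirl' (u : ℝ³ → ℝ³) (x : ℝ³) : ⟪u x, rotGen x⟫ = swirl u x := by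
  rw [real_inner_comm]
  exact inner_rotGen_eq_swirl u x

/-- The generator is skew: `⟪v, J w⟫ = -⟪J v, w⟫`. [folklore] -/
theorem inner_rotGen_right (v w : ℝ³) : ⟪v, rotGen w⟫ = -⟪rotGen v, w⟫ := by
  rw [real_inner_comm, inner_rotGen_left, inner_rotGen_left]
  ring

/-- **`φ J` is a test field.** For a scalar space–time test function `φ` on `Q`, the vector field
`(t, x) ↦ φ(t, x) J x` is a space–time test field on `Q` (`J` is linear). [folklore] -/
theorem isSpaceTimeTestOn_smul_rotGen (hφ : IsSpaceTimeTestOn Q φ) :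
    IsSpaceTimeTestOn Q (fun t x => φ t x • rotGen x) := by
  have heq : uncurry (fun t x => φ t x • rotGen x) =
      fun z : ℝ × ℝ³ => uncurry φ z • rotGenL z.2 := by
    funext z
    rfl
  refine ⟨?_, ?_, ?_⟩
  · rw [heq]
    exact hφ.contDiff.smul (rotGenL.contDiff.comp contDiff_snd)
  · rw [heq]
    exact hφ.hasCompactSupport.smul_right
  · rw [heq]
    exact (tsupport_smul_subset_left _ _).trans hφ.tsupport_subset

/-- `∂ₜ(φ J) = (∂ₜφ) J`. [folklore] -/
theorem timeDeriv_smul_rotGen (hφ : IsSpaceTimeTestOn Q φ) (t : ℝ) (x : ℝ³) :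
    timeDeriv (fun s y => φ s y • rotGen y) t x = timeDeriv φ t x • rotGen x := by
  simp only [timeDeriv]
  exact deriv_smul_const (hφ.hasDerivAt_time t x).differentiableAt _

/-- `(u·∇)(f J) = (Df[u]) J + f J u`. [folklore] -/
theorem convect_smul_rotGen {f : ℝ³ → ℝ} {x : ℝ³} (hf : DifferentiableAt ℝ f x) (u : ℝ³ → ℝ³) :
    convect u (fun y => f y • rotGen y) x = (fderiv ℝ f x (u x)) • rotGen x + f x • rotGen (u x) := by
  rw [convect_apply, fderiv_smul_rotGen_apply hf]

/-- `⟪u, (u·∇)(f J)⟫ = Df[u] · (x₀u₁ - x₁u₀)` (the term `f ⟪u, J u⟫` vanishes). [folklore] -/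
theorem inner_convect_smul_rotGen {f : ℝ³ → ℝ} {x : ℝ³} (hf : DifferentiableAt ℝ f x)
    (u : ℝ³ → ℝ³) :
    ⟪u x, convect u (fun y => f y • rotGen y) x⟫ = fderiv ℝ f x (u x) * swirl u x := by
  rw [convect_smul_rotGen hf, inner_add_right, inner_smul_right, inner_smul_right,
    inner_rotGen_eq_swirl', real_inner_comm (rotGen (u x)) (u x), inner_rotGen_self, mul_zero,
    add_zero]

/-- `div (f J) = ⟪J x, ∇f⟫` (`div J = 0`). [folklore] -/
theorem divergence_smul_rotGen {f : ℝ³ → ℝ} {x : ℝ³} (hf : DifferentiableAt ℝ f x) :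
    VectorCalculus.divergence (fun y => f y • rotGen y) x = ⟪rotGen x, gradient f x⟫ := by
  -- `div J = 0`: the generator is a traceless linear map (the tree's
  -- `divergence_rotGen_eq_zero`, `PeriodicCylinderWithinCalculus`, not imported here)
  have hJ : VectorCalculus.divergence rotGen x = 0 := by
    rw [divergence_eq_sum_inner_fderiv (EuclideanSpace.basisFun (Fin 3) ℝ), fderiv_rotGen]
    refine Finset.sum_eq_zero fun i _ => ?_
    rw [rotGenL_apply, real_inner_comm, inner_rotGen_self]
  rw [divergence_smul_apply hf (hasFDerivAt_rotGen x).differentiableAt, hJ, mul_zero, zero_add]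

/-- `⟪u, Δ(f J)⟫ = (Δf)(x₀u₁ - x₁u₀) - 2 ⟪J u, ∇f⟫` (`Δ(fJ) = (Δf) J + 2 J ∇f`, `J` skew).
[folklore] -/
theorem inner_laplacian_smul_rotGen {f : ℝ³ → ℝ} (hf : ContDiff ℝ 2 f) (u : ℝ³ → ℝ³) (x : ℝ³) :
    ⟪u x, Δ (fun y => f y • rotGen y) x⟫ = (Δ f) x * swirl u x - 2 * ⟪rotGen (u x), gradient f x⟫ := by
  rw [laplacian_smul_rotGen hf, inner_add_right, inner_smul_right, inner_smul_right,
    inner_rotGen_eq_swirl', inner_rotGen_right]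
  ring

end RotGenTests

/-! ### Space–time rotations about the axis -/

section SpaceTimeRotation

/-- The space–time rotation `(t, x) ↦ (t, R_θ x)` about the axis. [folklore] -/
def stRot (θ : ℝ) (z : ℝ × ℝ³) : ℝ × ℝ³ :=
  (z.1, rotZ θ z.2)

/-- Time is unchanged. [folklore] -/
@[simp] theorem stRot_fst (θ : ℝ) (z : ℝ × ℝ³) : (stRot θ z).1 = z.1 := rfl

/-- Space is rotated. [folklore] -/
@[simp] theorem stRot_snd (θ : ℝ) (z : ℝ × ℝ³) : (stRot θ z).2 = rotZ θ z.2 := rfl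

/-- `stRot (-θ)` undoes `stRot θ`. [folklore] -/
theorem stRot_neg_stRot (θ : ℝ) (z : ℝ × ℝ³) : stRot (-θ) (stRot θ z) = z := by
  simp only [stRot]
  rw [← rotZ_add, neg_add_cancel, rotZ_zero]

/-- `stRot θ` undoes `stRot (-θ)`. [folklore] -/
theorem stRot_stRot_neg (θ : ℝ) (z : ℝ × ℝ³) : stRot θ (stRot (-θ) z) = z := by
  simpa using stRot_neg_stRot (-θ) z

/-- The space–time rotation is continuous. [folklore] -/
theorem continuous_stRot (θ : ℝ) : Continuous (stRot θ) :=
  continuous_fst.prodMk ((rotZL θ).continuous.comp continuous_snd)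

/-- The space–time rotation is smooth (it is linear). [folklore] -/
theorem contDiff_stRot (θ : ℝ) {n : WithTop ℕ∞} : ContDiff ℝ n (stRot θ) :=
  contDiff_fst.prodMk ((rotZL θ).contDiff.comp contDiff_snd)

/-- The space–time rotation as a homeomorphism (inverse `stRot (-θ)`). [folklore] -/
def stRotHomeomorph (θ : ℝ) : (ℝ × ℝ³) ≃ₜ (ℝ × ℝ³) where
  toFun := stRot θ
  invFun := stRot (-θ)
  left_inv := stRot_neg_stRot θ
  right_inv := stRot_stRot_neg θ
  continuous_toFun := continuous_stRot θ
  continuous_invFun := continuous_stRot (-θ)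

/-- The space–time rotation preserves Lebesgue measure. [folklore] -/
theorem measurePreserving_stRot (θ : ℝ) :
    MeasurePreserving (stRot θ) (volume : Measure (ℝ × ℝ³)) volume := by
  have h : stRot θ = Prod.map id (rotZLIE θ) := by
    funext z
    rfl
  rw [h]
  exact (MeasurePreserving.id (volume : Measure ℝ)).prod (rotZLIE θ).measurePreserving

/-- The space–time rotation is a measurable embedding. [folklore] -/
theorem measurableEmbedding_stRot (θ : ℝ) : MeasurableEmbedding (stRot θ) :=
  (stRotHomeomorph θ).measurableEmbedding

/-- A rotation-invariant set is its own preimage under each space–time rotation. [folklore] -/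
theorem preimage_stRot_eq {Q : Set (ℝ × ℝ³)} (hQ : ∀ θ : ℝ, ∀ z ∈ Q, stRot θ z ∈ Q) (θ : ℝ) :
    stRot θ ⁻¹' Q = Q := by
  ext z
  refine ⟨fun hz => ?_, fun hz => hQ θ z hz⟩
  have h := hQ (-θ) _ hz
  rwa [stRot_neg_stRot] at h

/-- The shell cylinders `𝒞(R₁, R₂; a) × ]-b², 0[` are rotation invariant. [folklore] -/
theorem stRot_mem_shellCyl_iff {R₁ R₂ a b : ℝ} (θ : ℝ) {z : ℝ × ℝ³} :
    stRot θ z ∈ shellCyl R₁ R₂ a b ↔ z ∈ shellCyl R₁ R₂ a b := by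
  rw [mem_shellCyl, mem_shellCyl, stRot_fst, stRot_snd, cylRadius_rotZ, rotZ_apply_two]

/-- `(θ, x) ↦ R_θ x` is jointly continuous. [folklore] -/
theorem continuous_rotZ_prod : Continuous fun p : ℝ × ℝ³ => rotZ p.1 p.2 := by
  unfold rotZ
  refine (PiLp.continuous_toLp 2 _).comp ?_
  refine continuous_pi fun i => ?_
  have h0 : Continuous fun p : ℝ × ℝ³ => p.2 0 := (PiLp.continuous_apply 2 _ 0).comp continuous_snd
  have h1 : Continuous fun p : ℝ × ℝ³ => p.2 1 := (PiLp.continuous_apply 2 _ 1).comp continuous_snd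
  have h2 : Continuous fun p : ℝ × ℝ³ => p.2 2 := (PiLp.continuous_apply 2 _ 2).comp continuous_snd
  have hc : Continuous fun p : ℝ × ℝ³ => Real.cos p.1 := Real.continuous_cos.comp continuous_fst
  have hs : Continuous fun p : ℝ × ℝ³ => Real.sin p.1 := Real.continuous_sin.comp continuous_fst
  fin_cases i
  · exact ((hc.mul h0).sub (hs.mul h1)).congr fun p => by simp
  · exact ((hs.mul h0).add (hc.mul h1)).congr fun p => by simp
  · exact h2.congr fun p => by simp

/-- `(θ, z) ↦ stRot θ z` is jointly continuous. [folklore] -/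
theorem continuous_stRot_prod : Continuous fun p : ℝ × (ℝ × ℝ³) => stRot p.1 p.2 := by
  have h1 : Continuous fun p : ℝ × (ℝ × ℝ³) => p.2.1 := continuous_snd.fst
  have h2 : Continuous fun p : ℝ × (ℝ × ℝ³) => rotZ p.1 p.2.2 :=
    continuous_rotZ_prod.comp₂ continuous_fst continuous_snd.snd
  exact h1.prodMk h2

/-- A full turn is the identity: `R_{2π} = id`. [folklore] -/
theorem rotZ_two_pi (x : ℝ³) : rotZ (2 * Real.pi) x = x := by
  ext i
  fin_cases i <;> simp

/-- `J (R_θ x) = -sin θ (x₀, x₁, 0) + cos θ J x`: the generator at the rotated point is the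
velocity of `θ ↦ R_θ x` (`hasDerivAt_rotZ`). [folklore] -/
theorem rotGen_rotZ_eq (θ : ℝ) (x : ℝ³) :
    rotGen (rotZ θ x) = -Real.sin θ • (toLp 2 ![x 0, x 1, 0] : ℝ³) + Real.cos θ • rotGen x := by
  ext i
  fin_cases i <;> simp [rotGen] <;> ring

end SpaceTimeRotation

/-! ### Rotated and conjugated test fields -/

section RotatedTests

variable {F : Type*} [NormedAddCommGroup F] [NormedSpace ℝ F]
variable {Q : Opens (ℝ × ℝ³)}

/-- **Rotating a test function.** On a rotation-invariant open set `Q`, `(t, x) ↦ ψ(t, R_θ x)` is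
a space–time test function on `Q` whenever `ψ` is. [folklore] -/
theorem isSpaceTimeTestOn_comp_stRot
    (hQ : ∀ θ : ℝ, ∀ z ∈ (Q : Set (ℝ × ℝ³)), stRot θ z ∈ (Q : Set (ℝ × ℝ³)))
    {ψ : ℝ → ℝ³ → F} (hψ : IsSpaceTimeTestOn Q ψ) (θ : ℝ) :
    IsSpaceTimeTestOn Q (fun t x => ψ t (rotZ θ x)) := by
  have heq : uncurry (fun t x => ψ t (rotZ θ x)) = uncurry ψ ∘ stRot θ := by
    funext z
    rfl
  refine ⟨?_, ?_, ?_⟩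
  · rw [heq]
    exact hψ.contDiff.comp (contDiff_stRot θ)
  · rw [heq]
    exact hψ.hasCompactSupport.comp_homeomorph (stRotHomeomorph θ)
  · rw [heq]
    calc tsupport (uncurry ψ ∘ stRot θ)
        = closure (stRot θ ⁻¹' support (uncurry ψ)) := by
          rw [tsupport, support_comp_eq_preimage]
      _ ⊆ stRot θ ⁻¹' tsupport (uncurry ψ) := (continuous_stRot θ).closure_preimage_subset _
      _ ⊆ stRot θ ⁻¹' (Q : Set (ℝ × ℝ³)) := preimage_mono hψ.tsupport_subset
      _ = (Q : Set (ℝ × ℝ³)) := preimage_stRot_eq hQ θ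

/-- The conjugated field `ψ_θ(t, x) = R_θ⁻¹ ψ(t, R_θ x)`. [folklore] -/
def rotConj (θ : ℝ) (ψ : ℝ → ℝ³ → ℝ³) : ℝ → ℝ³ → ℝ³ :=
  fun t x => rotZ (-θ) (ψ t (rotZ θ x))

/-- Unfolding `rotConj`. [folklore] -/
@[simp] theorem rotConj_apply (θ : ℝ) (ψ : ℝ → ℝ³ → ℝ³) (t : ℝ) (x : ℝ³) :
    rotConj θ ψ t x = rotZ (-θ) (ψ t (rotZ θ x)) := rfl

/-- **Conjugating a test field.** On a rotation-invariant open set `Q`, `ψ_θ = R_θ⁻¹ ψ(·, R_θ ·)`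
is a space–time test field on `Q` whenever `ψ` is. [folklore] -/
theorem isSpaceTimeTestOn_rotConj
    (hQ : ∀ θ : ℝ, ∀ z ∈ (Q : Set (ℝ × ℝ³)), stRot θ z ∈ (Q : Set (ℝ × ℝ³)))
    {ψ : ℝ → ℝ³ → ℝ³} (hψ : IsSpaceTimeTestOn Q ψ) (θ : ℝ) :
    IsSpaceTimeTestOn Q (rotConj θ ψ) := by
  have h1 := isSpaceTimeTestOn_comp_stRot hQ hψ θ
  have heq : uncurry (rotConj θ ψ) = rotZL (-θ) ∘ uncurry (fun t x => ψ t (rotZ θ x)) := by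
    funext z
    rfl
  refine ⟨?_, ?_, ?_⟩
  · rw [heq]
    exact (rotZL (-θ)).contDiff.comp h1.contDiff
  · rw [heq]
    exact h1.hasCompactSupport.comp_left (map_zero _)
  · rw [heq]
    exact (tsupport_comp_subset (map_zero _) _).trans h1.tsupport_subset

/-! ### Rotation covariance of the weak Navier–Stokes integrand -/

/-- `∂ₜψ_θ(t, x) = R_θ⁻¹ ∂ₜψ(t, R_θ x)`. [folklore] -/
theorem timeDeriv_rotConj {ψ : ℝ → ℝ³ → ℝ³} (hψ : IsSpaceTimeTestOn Q ψ) (θ t : ℝ) (x : ℝ³) :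
    timeDeriv (rotConj θ ψ) t x = rotZ (-θ) (timeDeriv ψ t (rotZ θ x)) := by
  simp only [timeDeriv, rotConj]
  exact ((rotZL (-θ)).hasFDerivAt.comp_hasDerivAt t (hψ.hasDerivAt_time t (rotZ θ x))).deriv

/-- `(u·∇)ψ_θ (x) = R_θ⁻¹ Dψ(R_θ x)[R_θ u(x)]` (chain rule). [folklore] -/
theorem convect_rotConj (ψ : ℝ → ℝ³ → ℝ³) (u : ℝ³ → ℝ³) (θ t : ℝ) (x : ℝ³) :
    convect u (rotConj θ ψ t) x = rotZ (-θ) (fderiv ℝ (ψ t) (rotZ θ x) (rotZ θ (u x))) := by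
  have h := fderiv_conj_linearIsometryEquiv (rotZLIE θ).symm (ψ t) x
  have e : rotConj θ ψ t = fun y => (rotZLIE θ).symm (ψ t ((rotZLIE θ).symm.symm y)) := rfl
  rw [convect_apply, e, h]
  rfl

/-- `Δψ_θ (x) = R_θ⁻¹ (Δψ)(R_θ x)` (the Laplacian commutes with isometries). [folklore] -/
theorem laplacian_rotConj (ψ : ℝ → ℝ³ → ℝ³) (θ t : ℝ) (x : ℝ³) :
    Δ (rotConj θ ψ t) x = rotZ (-θ) (Δ (ψ t) (rotZ θ x)) := by
  have h := laplacian_conj_linearIsometryEquiv (rotZLIE θ).symm (ψ t) x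
  have e : rotConj θ ψ t = fun y => (rotZLIE θ).symm (ψ t ((rotZLIE θ).symm.symm y)) := rfl
  rw [e, h]
  rfl

/-- `div ψ_θ (x) = (div ψ)(R_θ x)` (trace of a conjugate). [folklore] -/
theorem divergence_rotConj (ψ : ℝ → ℝ³ → ℝ³) (θ t : ℝ) (x : ℝ³) :
    VectorCalculus.divergence (rotConj θ ψ t) x = VectorCalculus.divergence (ψ t) (rotZ θ x) := by
  have h := divergence_conj_linearIsometryEquiv (rotZLIE θ).symm (ψ t) x
  have e : rotConj θ ψ t = fun y => (rotZLIE θ).symm (ψ t ((rotZLIE θ).symm.symm y)) := rfl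
  rw [e, h]
  rfl

/-- `⟪v, R_θ⁻¹ w⟫ = ⟪R_θ v, w⟫`. [folklore] -/
theorem inner_rotZ_neg_right (θ : ℝ) (v w : ℝ³) : ⟪v, rotZ (-θ) w⟫ = ⟪rotZ θ v, w⟫ :=
  (LinearIsometryEquiv.inner_map_eq_flip (rotZLIE θ) v w).symm

/-- The velocity part `⟪V, ∂ₜψ⟫ + ⟪V, (V·∇)ψ⟫ + ν ⟪V, Δψ⟫` of the weak Navier–Stokes integrand
for a test field `ψ`, as a function of space–time. [folklore] -/
def nsVPart (ν : ℝ) (V : ℝ → ℝ³ → ℝ³) (ψ : ℝ → ℝ³ → ℝ³) (z : ℝ × ℝ³) : ℝ :=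
  ⟪V z.1 z.2, timeDeriv ψ z.1 z.2⟫ + ⟪V z.1 z.2, convect (V z.1) (ψ z.1) z.2⟫ +
    ν * ⟪V z.1 z.2, Δ (ψ z.1) z.2⟫

/-- **Covariance of the velocity part.** If `V` is equivariant at the points of `Q`
(`V(t, R_θ x) = R_θ V(t, x)`), then for a test field `ψ` on `Q` and `z = (t, x) ∈ Q` the velocity
part of the weak integrand for the conjugated field `ψ_θ` at `z` is the velocity part for `ψ` at
`(t, R_θ x)`. [folklore] -/
theorem nsVPart_rotConj {ν : ℝ} {V : ℝ → ℝ³ → ℝ³} (hV : IsAxisymmetricOn (Q : Set (ℝ × ℝ³)) V)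
    {ψ : ℝ → ℝ³ → ℝ³} (hψ : IsSpaceTimeTestOn Q ψ) (θ : ℝ) {z : ℝ × ℝ³}
    (hz : z ∈ (Q : Set (ℝ × ℝ³))) :
    nsVPart ν V (rotConj θ ψ) z = nsVPart ν V ψ (stRot θ z) := by
  have hVz : V z.1 (rotZ θ z.2) = rotZ θ (V z.1 z.2) := hV θ z hz
  simp only [nsVPart, stRot_fst, stRot_snd]
  rw [timeDeriv_rotConj hψ, convect_rotConj, laplacian_rotConj, inner_rotZ_neg_right,
    inner_rotZ_neg_right, inner_rotZ_neg_right, ← hVz, convect_apply]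

end RotatedTests

end SereginZajaczkowski2007

end Literature.Analysis.FluidPDE
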